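import Literature.IUT.HodgeTheaters.TemperedCoveringsProp24SubProofs
import Literature.IUT.HodgeTheaters.TemperedCoveringsProp24iiiSub
import HarnessLib

/-!
# [IUTchI] Prop. 2.4 (i): the inverse-limit step (INV) REDUCED to its tempered half — PROOFS

Mochizuki, *Inter-universal Teichmüller theory I: construction of Hodge theaters*, kurims manuscript
(May 2020), §2, Proposition 2.4 (i), proof p. 50 l. 40–42 ([IUTchI] Prop 2.4(i) p.50)
[claim: Mochizuki2012, status: disputed] (D-0012 claim key; series status DISPUTED — nothing of the series is
asserted here): "Since, by allowing `J` to vary, `Π^tp_X` (respectively, `Π̂_X`) may be written as an inverse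
limit of the topological groups `Π^tp_X/Ker(J ↠ Π^tp_{𝔾_J})` (respectively, `Π̂_X/Ker(Ĵ ↠ Π̂_{𝔾_J})`), we thus
conclude that [the original] `γ` lies in `Π^tp_X`".

PROOF-ONLY companion (no definitions) of abc-iut-w5-d119's sub-DAG statements file
`TemperedCoveringsProp24Sub.lean` (p414324; plan/L5/SUBDAG-IUTchI-Prop24.md row P24i.r9), whose named
sub-node (INV) `Prop24Tower.DetectsTempered` packages the displayed sentence WHOLE, as an input about the
genuine tower.  Here (INV) is DERIVED from:

* the TEMPERED half of the sentence alone, in elementary form (hypothesis `hlim` of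
  `Prop24Tower.detectsTempered_of_inverseLimit`): every family of left cosets
  `(t_i · K_i)_{Ĵ_i ⊆ W}`, `K_i := ι⁻¹(Ker(Ĵ_i ↠ Π̂_{𝔾_{J_i}}))` (`= Ker(J_i ↠ Π^tp_{𝔾_{J_i}})` pushed into
  `Π^tp_X`, see `ιX_mem_kerHat_iff`), compatible along the levels below `W`, is the family of cosets of ONE
  `s ∈ Π^tp_X` — i.e. "`Π^tp_X ↠ lim_J Π^tp_X/Ker(J ↠ Π^tp_{𝔾_J})`" over the cofinal family of levels below
  any given level;
* the monotonicity of the kernels along the tower (`hmono`: `Ĵ_j ⊆ Ĵ_i ⇒ Ker(Ĵ_j ↠ Π̂_{𝔾_{J_j}}) ⊆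
  Ker(Ĵ_i ↠ Π̂_{𝔾_{J_i}})`, the compatibility of the specialisation maps of a cover and a sub-cover — the
  tower structure `Prop24Tower` records no transition maps, so this is an explicit input);
* and the level bookkeeping already named in the statements file (`LevelsInDelta`, `LevelsOpen`,
  `LevelsCofinal`, `DeltaHatClosed`) with `Π̂_X` profinite — from which the PROFINITE half of the displayed
  sentence is not needed at all: what the argument uses of it is only `⋂_{Ĵ ⊆ W} Ĵ = {1}`
  (`eq_one_of_forall_mem_level`), a consequence of cofinality.

Net effect for the sub-DAG: row P24i.r9's merge input shrinks from "structure of the tempered AND profinite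
tower" to the single tempered completeness statement `hlim` (+ `hmono`), which is exactly what
[André] §4 / [SemiAnbd] Prop. 3.6 supply for the genuine `Σ̂`-tempered fundamental group (every open normal
subgroup of the defining system of `Π^tp_X` contains some `Ker(J ↠ Π^tp_{𝔾_J})`: discrete quotients of the
tempered fundamental group of `X_J` arise from graph-coverings of the special fibre).  NOTE (recorded, neutral):
for an ABSTRACT dense subgroup the displayed sentence would be false (`ℤ + nẐ = Ẑ` for every `n`), so (INV) is
a genuine input about tempered groups, not formal topology; this file only separates its two halves.
Capstones: `prop24i_of_sub_of_inverseLimit`, and — with abc-iut-L5-t11's cusp route to the pro-`Σ` Sylow atom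
(`proSigmaSylowAtom_of_equiv_zHat`, p415779; under the sub-DAG's name `hasCompactProSigma_of_equiv_zHat`,
p416171) — `prop24iii_of_sub_of_inverseLimit_of_equiv_zHat`.
Seat abc-iut-L5-t11 (gen 5).  Nothing here bears on [IUTchIII] Cor. 3.12; typed ≠ discharged.
-/

namespace Literature.IUT.HodgeTheaters

open _root_.Topology
open Literature.AnabelianGeometry.SemiGraphs (IsProSigma)

universe u

namespace StableCurveTemperedData

variable {D : StableCurveTemperedData.{u}}

namespace Prop24Tower

variable (T : D.Prop24Tower)

/-! ### The kernels `Ker(Ĵ_i ↠ Π̂_{𝔾_{J_i}}) ⊆ Π̂_X` and their tempered traces -/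

/-- Membership in `Ker(Ĵ_i ↠ Π̂_{𝔾_{J_i}})`, viewed as a subgroup of `Π̂_X`.
[cite: Mochizuki2012, Prop 2.4(i) p.50] -/
theorem mem_kerHat_iff {i : T.I} {y : D.PiHat} :
    y ∈ ((T.πhat i).ker.map (T.Jhat i).subtype) ↔ ∃ hy : y ∈ T.Jhat i, T.πhat i ⟨y, hy⟩ = 1 := by
  constructor
  · rintro ⟨z, hz, rfl⟩
    exact ⟨z.2, MonoidHom.mem_ker.mp hz⟩
  · rintro ⟨hy, h1⟩
    exact ⟨⟨y, hy⟩, MonoidHom.mem_ker.mpr h1, rfl⟩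

/-- `Ker(Ĵ_i ↠ Π̂_{𝔾_{J_i}}) ⊆ Ĵ_i`. [cite: Mochizuki2012, Prop 2.4(i) p.50] -/
theorem kerHat_le (i : T.I) : ((T.πhat i).ker.map (T.Jhat i).subtype) ≤ T.Jhat i :=
  Subgroup.map_subtype_le _

/-- The tempered trace of `Ker(Ĵ_i ↠ Π̂_{𝔾_{J_i}})` is print's `Ker(J_i ↠ Π^tp_{𝔾_{J_i}})` (p. 50 l. 41):
for `t ∈ Π^tp_X`, `ι(t)` dies in `Π̂_{𝔾_{J_i}}` iff `t ∈ J_i` and `t` dies in `Π^tp_{𝔾_{J_i}}` (compatibility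
`comp` of the tower and injectivity of `Π^tp_{𝔾} ↪ Π̂_{𝔾}`). [cite: Mochizuki2012, Prop 2.4(i) p.50] -/
theorem ιX_mem_kerHat_iff (hΔ : T.LevelsInDelta) {i : T.I} {t : D.PiTp} :
    D.ιX t ∈ ((T.πhat i).ker.map (T.Jhat i).subtype) ↔
      ∃ (ht : t ∈ D.DeltaTp) (hJ : D.ιX t ∈ T.Jhat i), T.πtp i ⟨⟨t, ht⟩, hJ⟩ = 1 := by
  rw [mem_kerHat_iff]
  constructor
  · rintro ⟨hJ, h1⟩
    have ht : t ∈ D.DeltaTp := by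
      rw [MonoidHom.mem_ker, ← D.prHat_ιX]
      exact hΔ i hJ
    refine ⟨ht, hJ, (T.G i).ι_injective ?_⟩
    rw [T.comp i ⟨t, ht⟩ hJ, map_one]
    exact h1
  · rintro ⟨ht, hJ, h1⟩
    refine ⟨hJ, ?_⟩
    have hc := T.comp i ⟨t, ht⟩ hJ
    rw [h1, map_one] at hc
    exact hc.symm

/-! ### Directedness and separation below a level (from cofinality) -/

/-- The levels are DIRECTED: below any two levels there is a third (open levels inside `Δ̂_X` are
cofinal). [cite: Mochizuki2012, Prop 2.4(i) p.50] -/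
theorem exists_level_le_and_le (hΔ : T.LevelsInDelta) (ho : T.LevelsOpen) (hcof : T.LevelsCofinal)
    (i i' : T.I) : ∃ j, T.Jhat j ≤ T.Jhat i ∧ T.Jhat j ≤ T.Jhat i' := by
  have hopen : IsOpen (((T.Jhat i ⊓ T.Jhat i').subgroupOf D.DeltaHat : Subgroup D.DeltaHat) :
      Set D.DeltaHat) := by
    have e : (((T.Jhat i ⊓ T.Jhat i').subgroupOf D.DeltaHat : Subgroup D.DeltaHat) : Set D.DeltaHat) =
        ((T.Jhat i).subgroupOf D.DeltaHat : Set D.DeltaHat) ∩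
          ((T.Jhat i').subgroupOf D.DeltaHat : Set D.DeltaHat) := by
      ext z
      simp only [SetLike.mem_coe, Subgroup.mem_subgroupOf, Subgroup.mem_inf, Set.mem_inter_iff]
    rw [e]
    exact (ho i).inter (ho i')
  obtain ⟨j, hj⟩ := hcof _ hopen
  refine ⟨j, fun y hy => ?_, fun y hy => ?_⟩
  · have h := hj (show (⟨y, hΔ j hy⟩ : D.DeltaHat) ∈ (T.Jhat j).subgroupOf D.DeltaHat from hy)
    exact (Subgroup.mem_inf.mp (Subgroup.mem_subgroupOf.mp h)).1
  · have h := hj (show (⟨y, hΔ j hy⟩ : D.DeltaHat) ∈ (T.Jhat j).subgroupOf D.DeltaHat from hy)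
    exact (Subgroup.mem_inf.mp (Subgroup.mem_subgroupOf.mp h)).2

/-- SEPARATION below a level: an element of `Π̂_X` lying in every level `Ĵ ⊆ W` (for a `W` containing
some level) is trivial — the only use the argument makes of the PROFINITE half of p. 50 l. 40–42
("`Π̂_X` may be written as an inverse limit of the `Π̂_X/Ker(Ĵ ↠ Π̂_{𝔾_J})`"), and a consequence of the
cofinality of the levels in the profinite `Δ̂_X`. [cite: Mochizuki2012, Prop 2.4(i) p.50] -/
theorem eq_one_of_forall_mem_level [T2Space D.PiHat] [TotallyDisconnectedSpace D.PiHat]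
    (hΔc : D.DeltaHatClosed) (hΔ : T.LevelsInDelta) (ho : T.LevelsOpen) (hcof : T.LevelsCofinal)
    {W : Subgroup D.PiHat} (hW : ∃ i, T.Jhat i ≤ W) {δ : D.PiHat}
    (hδ : ∀ i, T.Jhat i ≤ W → δ ∈ T.Jhat i) : δ = 1 := by
  obtain ⟨i₀, hi₀⟩ := hW
  have hδΔ : δ ∈ D.DeltaHat := hΔ i₀ (hδ i₀ hi₀)
  by_contra hne
  haveI : CompactSpace D.DeltaHat := isCompact_iff_compactSpace.mp hΔc.isCompact
  have hne' : (⟨δ, hδΔ⟩ : D.DeltaHat) ≠ 1 := fun h => hne (congrArg Subtype.val h)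
  obtain ⟨U, hU⟩ := ProfiniteGrp.exist_openNormalSubgroup_sub_open_nhds_of_one
    (isOpen_compl_singleton (x := (⟨δ, hδΔ⟩ : D.DeltaHat))) (by simpa using hne'.symm)
  have hδU : (⟨δ, hδΔ⟩ : D.DeltaHat) ∉ U := fun h => hU h rfl
  obtain ⟨j, hj⟩ := hcof U.toSubgroup U.isOpen'
  obtain ⟨j', hj'j, hj'i₀⟩ := T.exists_level_le_and_le hΔ ho hcof j i₀
  have hδj' : δ ∈ T.Jhat j' := hδ j' (hj'i₀.trans hi₀)
  exact hδU (hj (show (⟨δ, hδΔ⟩ : D.DeltaHat) ∈ (T.Jhat j).subgroupOf D.DeltaHat from hj'j hδj'))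

/-! ### (INV) from the tempered inverse limit -/

/-- **(INV) `DetectsTempered` DERIVED** (p. 50 l. 40–42) from: the TEMPERED completeness statement `hlim`
("`Π^tp_X` may be written as an inverse limit of the `Π^tp_X/Ker(J ↠ Π^tp_{𝔾_J})`", over the levels below
any given level, in left-coset form), the monotonicity `hmono` of the kernels along the tower, and the
cofinality bookkeeping with `Π̂_X` profinite.  Proof: if `γ ∈ ι(t_i)·Ker(Ĵ_i ↠ Π̂_{𝔾_{J_i}})` at every level
below `W`, the `t_i` form a compatible family (by `hmono`), so `hlim` gives one `s ∈ Π^tp_X` with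
`ι(s)⁻¹γ ∈ Ker(Ĵ_i ↠ Π̂_{𝔾_{J_i}}) ⊆ Ĵ_i` at every level below `W`; by separation `γ = ι(s)`.
[cite: Mochizuki2012, Prop 2.4(i) p.50] -/
theorem detectsTempered_of_inverseLimit [T2Space D.PiHat] [TotallyDisconnectedSpace D.PiHat]
    (hΔc : D.DeltaHatClosed) (hΔ : T.LevelsInDelta) (ho : T.LevelsOpen) (hcof : T.LevelsCofinal)
    (hmono : ∀ i j, T.Jhat j ≤ T.Jhat i →
      ((T.πhat j).ker.map (T.Jhat j).subtype) ≤ ((T.πhat i).ker.map (T.Jhat i).subtype))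
    (hlim : ∀ W : Subgroup D.PiHat, (∃ i, T.Jhat i ≤ W) → ∀ t : T.I → D.PiTp,
      (∀ i j, T.Jhat i ≤ W → T.Jhat j ≤ T.Jhat i →
        D.ιX ((t i)⁻¹ * t j) ∈ ((T.πhat i).ker.map (T.Jhat i).subtype)) →
      ∃ s : D.PiTp, ∀ i, T.Jhat i ≤ W → D.ιX (s⁻¹ * t i) ∈ ((T.πhat i).ker.map (T.Jhat i).subtype)) :
    T.DetectsTempered := by
  intro W hW γ hγ
  classical
  -- choose tempered representatives `t_i` with `ι(t_i)⁻¹ γ ∈ Ker(Ĵ_i ↠ Π̂_{𝔾_i})` at the levels below `W`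
  have key : ∀ i, ∃ t : D.PiTp, T.Jhat i ≤ W →
      (D.ιX t)⁻¹ * γ ∈ ((T.πhat i).ker.map (T.Jhat i).subtype) := by
    intro i
    by_cases hi : T.Jhat i ≤ W
    · obtain ⟨t, h, h1⟩ := hγ i hi
      exact ⟨t, fun _ => T.mem_kerHat_iff.mpr ⟨h, h1⟩⟩
    · exact ⟨1, fun h => absurd h hi⟩
  choose t ht using key
  -- the family is compatible along the levels below `W`
  have hcompat : ∀ i j, T.Jhat i ≤ W → T.Jhat j ≤ T.Jhat i →
      D.ιX ((t i)⁻¹ * t j) ∈ ((T.πhat i).ker.map (T.Jhat i).subtype) := by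
    intro i j hi hji
    have ha := ht i hi
    have hb := hmono i j hji (ht j (hji.trans hi))
    have e : D.ιX ((t i)⁻¹ * t j) = ((D.ιX (t i))⁻¹ * γ) * ((D.ιX (t j))⁻¹ * γ)⁻¹ := by
      simp only [map_mul, map_inv, mul_inv_rev, inv_inv]
      group
    rw [e]
    exact Subgroup.mul_mem _ ha (Subgroup.inv_mem _ hb)
  obtain ⟨s, hs⟩ := hlim W hW t hcompat
  -- `ι(s)⁻¹ γ` lies in every level below `W`
  have hδ : ∀ i, T.Jhat i ≤ W → (D.ιX s)⁻¹ * γ ∈ T.Jhat i := by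
    intro i hi
    have e : (D.ιX s)⁻¹ * γ = D.ιX (s⁻¹ * t i) * ((D.ιX (t i))⁻¹ * γ) := by
      simp only [map_mul, map_inv]
      group
    rw [e]
    exact T.kerHat_le i (Subgroup.mul_mem _ (hs i hi) (ht i hi))
  have hone := T.eq_one_of_forall_mem_level hΔc hΔ ho hcof hW hδ
  rw [inv_mul_eq_one] at hone
  exact ⟨s, hone⟩

end Prop24Tower

/-! ### Capstones: Prop. 2.4 (i), (iii) with (INV) replaced by the tempered inverse limit -/

/-- **[IUTchI] Prop. 2.4 (i) from the named sub-nodes, with (INV) replaced by its tempered half**: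
as `prop24i_of_sub` (p416099) but with `DetectsTempered` DERIVED from the tempered completeness statement
`hlim` and the kernel monotonicity `hmono` (`Prop24Tower.detectsTempered_of_inverseLimit`).
[cite: Mochizuki2012, Prop 2.4(i) p.50] -/
theorem prop24i_of_sub_of_inverseLimit [T2Space D.PiHat] [TotallyDisconnectedSpace D.PiHat]
    (T : D.Prop24Tower) (hΔc : D.DeltaHatClosed) (hd : D.DeltaHatDense)
    (hstf : D.StronglyTorsionFreeSigma) (hΔ : T.LevelsInDelta) (hn : T.LevelsNormal) (ho : T.LevelsOpen)
    (hcof : T.LevelsCofinal) (h21 : T.Prop21Levels) (hspec : T.SpecializationAb)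
    (hmono : ∀ i j, T.Jhat j ≤ T.Jhat i →
      ((T.πhat j).ker.map (T.Jhat j).subtype) ≤ ((T.πhat i).ker.map (T.Jhat i).subtype))
    (hlim : ∀ W : Subgroup D.PiHat, (∃ i, T.Jhat i ≤ W) → ∀ t : T.I → D.PiTp,
      (∀ i j, T.Jhat i ≤ W → T.Jhat j ≤ T.Jhat i →
        D.ιX ((t i)⁻¹ * t j) ∈ ((T.πhat i).ker.map (T.Jhat i).subtype)) →
      ∃ s : D.PiTp, ∀ i, T.Jhat i ≤ W → D.ιX (s⁻¹ * t i) ∈ ((T.πhat i).ker.map (T.Jhat i).subtype)) :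
    D.Prop24i :=
  prop24i_of_sub T hΔc hd hstf hΔ hn ho hcof h21 hspec
    (T.detectsTempered_of_inverseLimit hΔc hΔ ho hcof hmono hlim)

/-- **[IUTchI] Prop. 2.4 (iii) from the named sub-nodes, (INV) replaced by its tempered half, and the
pro-`Σ` Sylow input supplied by a cusp with `I_x ≅ Ẑ(1)`** (`Π^tp_X` Hausdorff; (iii) ⇐ (i) is p407271's
`prop24iii_of_prop24i'`). [cite: Mochizuki2012, Prop 2.4(iii) p.51] -/
theorem prop24iii_of_sub_of_inverseLimit_of_equiv_zHat [T2Space D.PiHat] [TotallyDisconnectedSpace D.PiHat]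
    [T2Space D.PiTp] (T : D.Prop24Tower) (hΔc : D.DeltaHatClosed) (hd : D.DeltaHatDense)
    (hstf : D.StronglyTorsionFreeSigma) (hΔ : T.LevelsInDelta) (hn : T.LevelsNormal) (ho : T.LevelsOpen)
    (hcof : T.LevelsCofinal) (h21 : T.Prop21Levels) (hspec : T.SpecializationAb)
    (hmono : ∀ i j, T.Jhat j ≤ T.Jhat i →
      ((T.πhat j).ker.map (T.Jhat j).subtype) ≤ ((T.πhat i).ker.map (T.Jhat i).subtype))
    (hlim : ∀ W : Subgroup D.PiHat, (∃ i, T.Jhat i ≤ W) → ∀ t : T.I → D.PiTp,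
      (∀ i j, T.Jhat i ≤ W → T.Jhat j ≤ T.Jhat i →
        D.ιX ((t i)⁻¹ * t j) ∈ ((T.πhat i).ker.map (T.Jhat i).subtype)) →
      ∃ s : D.PiTp, ∀ i, T.Jhat i ≤ W → D.ιX (s⁻¹ * t i) ∈ ((T.πhat i).ker.map (T.Jhat i).subtype))
    {x : D.Cusp} (e : ↥(D.inertiaTp x) ≃ₜ* ZHat) : D.Prop24iii :=
  D.prop24iii_of_prop24i' (prop24i_of_sub_of_inverseLimit T hΔc hd hstf hΔ hn ho hcof h21 hspec hmono hlim)
    (D.hasCompactProSigma_of_equiv_zHat e)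

end StableCurveTemperedData

end Literature.IUT.HodgeTheaters
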